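import Summits.SmoothPoincare4.SmoothPoincare4.Theorems.CylinderEntropyCylinderRungTwoKillingFluxDefs
import Summits.SmoothPoincare4.SmoothPoincare4.Theorems.CylinderEntropyCylinderRungTwoEpsilonRegularityOfWhite
import Summits.SmoothPoincare4.SmoothPoincare4.Theorems.CylinderEntropyCylinderRungTwoDissipationBudget
import Summits.SmoothPoincare4.SmoothPoincare4.Theorems.CylinderEntropyCylinderRungTwoAreaToFloorOfQuantization
import HarnessLib

/-!
# Route `CylinderEntropy`, item `ImmortalAreaToFloor` (stmt-SmoothPoincare4-17197):
# the THIN SEQUENCE FORM of the residual and its place in the ladder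

Companion of `…ImmortalAreaToFloorOfSmallTilt.lean` (same seat).  The cleanest flow-free residual of the item is
the following THIN AREA-TO-FLOOR FOR ALMOST-STATIONARY SEQUENCES (`ThinSeq`, spelled inline as a hypothesis below):
for ONE compact connected `M`, every sequence of embedded separating cross-sections `ι_k : M → N = S⁴ × ℝ ⊂ ℝ⁶`
with smooth unit normals `ν_k` tangent to `N`, heights `|z₅| ≤ B`, cylinder entropies `λ_cyl(ι_k M) ≤ 2 - δ`
(`δ > 0`), Willmore energies `∫ H_k² d(ι_k^*μH⁴) → 0` and areas `μH⁴(ι_k M) → A < ⊤` has `A ≤ μH⁴(S⁴)` (hence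
`= μH⁴(S⁴)` by the area floor).  It sits between the route's crux and the item:

* `thinSeq_of_areaQuantization` — the crux `AreaQuantization` (stmt-SmoothPoincare4-17175: `A ∈ ℕ · vol`, WITHOUT
  the entropy hypothesis; Allard's integrality) implies `ThinSeq` (`vol ≤ A ≤ (2 - δ) vol < 2 vol` forces `m = 1`);
* `thinSeq_of_areaNearFloorOfSmallWillmore` — so does the `ε`-form "WILLMORE-SMALL THIN CROSS-SECTIONS IN A SLAB
  HAVE AREA NEAR THE FLOOR" (for all `δ, η > 0` and `B` one `ε > 0` works for every `M`);
* `areaToFloor_of_thinSeq` / `immortalAreaToFloor_of_thinSeq` — and `ThinSeq` implies the item (good times of the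
  dissipation budget with `∫ H² → 0`, convergent antitone areas, the uniform height bound and the uniform entropy
  gap of `…ImmortalAreaToFloorOfSmallTilt.lean`, as in the landed `helper_areaToFloorOfQuantization`).

So `ThinSeq` is implied by `AreaQuantization` and implies `ImmortalAreaToFloor`; it is the statement an
Allard-free proof should target: the entropy gap `2 - δ` is available at every scale (two nearly coincident sheets
over a ball `D_s` already have typed density `≈ 2(1 - o(1)) > 2 - δ` at scale `s/L(δ)`), and only the `m = 1` case
of the quantization is asserted.  Everything here is proved; no `sorry`, no definition, no named fact.

References: W. K. Allard, *On the first variation of a varifold*, Ann. of Math. 95 (1972), Thm. 6.4, §3.5 (the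
quantization input it replaces); R. S. Hamilton, Comm. Anal. Geom. 1 (1993) 127–137, Thm. 4.1; K. Brakke, *The
motion of a surface by its mean curvature* (1978), §3.
-/

noncomputable section

-- the prescribed namespace `Summit.SmoothPoincare4.SmoothPoincare4.…` repeats `SmoothPoincare4`
set_option linter.dupNamespace false

open MeasureTheory Set Filter
open scoped Manifold ContDiff ENNReal NNReal Topology BigOperators

namespace Summit.SmoothPoincare4.SmoothPoincare4.Cruxes.CylinderRungTwo.KillingFlux

open Literature.Geometry.Riemannian
open Literature.Geometry.Lorentzian Literature.Geometry.Lorentzian.PseudoRiemannianMetric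
open Literature.Geometry.Riemannian.SphericalCylinderEntropy

/-- **`AreaQuantization` implies the thin sequence form.**  If almost-stationary slab-confined separating
cross-section sequences have area limits in `ℕ · vol` (the route's crux `AreaQuantization`, stmt-SmoothPoincare4-17175,
spelled as in `helper_areaToFloorOfQuantization`), then such sequences with the additional entropy bound
`λ_cyl(ι_k M) ≤ 2 - δ`, `δ > 0`, have area limit `A ≤ vol`: every area is `≥ vol` (area floor,
`floor_le_of_separatesEnds`) and `≤ (2 - δ) vol` (`measure_ratio_le_cylEntropy`), so `vol ≤ m · vol ≤ (2-δ) vol`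
and `m = 1`. [cite: Allard1972, Thm. 6.4 and 3.5] -/
theorem thinSeq_of_areaQuantization
    (hquant : ∀ (M : Type) [TopologicalSpace M] [T2Space M] [SecondCountableTopology M]
      [ChartedSpace (EuclideanSpace ℝ (Fin 4)) M] [IsManifold (𝓡 4) ∞ M] [CompactSpace M] [ConnectedSpace M]
      [MeasurableSpace M] [BorelSpace M]
      (ι : ℕ → M → EuclideanSpace ℝ (Fin 6)) (ν : ℕ → M → EuclideanSpace ℝ (Fin 6)),
      (∀ k, Manifold.IsSmoothEmbedding (𝓡 4) (𝓡 6) ∞ (ι k)) →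
      (∀ k x, ∑ i : Fin 5, ι k x (Fin.castSucc i) ^ 2 = 1) →
      (∀ k, SeparatesEnds (Set.range (ι k))) →
      ∀ himm : ∀ k, (euclideanMetric (EuclideanSpace ℝ (Fin 6))).IsSpacelikeImmersion (𝓡 4) (ι k),
      (∀ k, (euclideanMetric (EuclideanSpace ℝ (Fin 6))).IsUnitNormal (𝓡 4) (ι k) (ν k) 1) →
      (∀ k x, ∑ i : Fin 5, ν k x (Fin.castSucc i) * ι k x (Fin.castSucc i) = 0) →
      (∀ k, ContMDiff (𝓡 4) (𝓡 6) ∞ (ν k)) →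
      ∀ B : ℝ, (∀ k x, |ι k x 5| ≤ B) →
      Filter.Tendsto (fun k => ∫⁻ x, ENNReal.ofReal
          ((euclideanMetric (EuclideanSpace ℝ (Fin 6))).meanCurvature (ι k) contMDiff_pullbackBilin_holds (himm k)
            (ν k) x ^ 2) ∂(Measure.comap (ι k) (μH[4] : Measure (EuclideanSpace ℝ (Fin 6))))) Filter.atTop (𝓝 0) →
      ∀ A : ℝ≥0∞, A < ⊤ →
      Filter.Tendsto (fun k => μH[4] (Set.range (ι k))) Filter.atTop (𝓝 A) →
      ∃ m : ℕ, A = m * μH[4] (Metric.sphere (0 : EuclideanSpace ℝ (Fin 5)) 1)) :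
    ∀ (M : Type) [TopologicalSpace M] [T2Space M] [SecondCountableTopology M]
      [ChartedSpace (EuclideanSpace ℝ (Fin 4)) M] [IsManifold (𝓡 4) ∞ M] [CompactSpace M] [ConnectedSpace M]
      [MeasurableSpace M] [BorelSpace M]
      (ι : ℕ → M → EuclideanSpace ℝ (Fin 6)) (ν : ℕ → M → EuclideanSpace ℝ (Fin 6)),
      (∀ k, Manifold.IsSmoothEmbedding (𝓡 4) (𝓡 6) ∞ (ι k)) →
      (∀ k x, ∑ i : Fin 5, ι k x (Fin.castSucc i) ^ 2 = 1) →
      (∀ k, SeparatesEnds (Set.range (ι k))) →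
      ∀ himm : ∀ k, (euclideanMetric (EuclideanSpace ℝ (Fin 6))).IsSpacelikeImmersion (𝓡 4) (ι k),
      (∀ k, (euclideanMetric (EuclideanSpace ℝ (Fin 6))).IsUnitNormal (𝓡 4) (ι k) (ν k) 1) →
      (∀ k x, ∑ i : Fin 5, ν k x (Fin.castSucc i) * ι k x (Fin.castSucc i) = 0) →
      (∀ k, ContMDiff (𝓡 4) (𝓡 6) ∞ (ν k)) →
      ∀ B : ℝ, (∀ k x, |ι k x 5| ≤ B) →
      ∀ δ : ℝ, 0 < δ → (∀ k, cylEntropy (Set.range (ι k)) ≤ ENNReal.ofReal (2 - δ)) →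
      Filter.Tendsto (fun k => ∫⁻ x, ENNReal.ofReal
          ((euclideanMetric (EuclideanSpace ℝ (Fin 6))).meanCurvature (ι k) contMDiff_pullbackBilin_holds (himm k)
            (ν k) x ^ 2) ∂(Measure.comap (ι k) (μH[4] : Measure (EuclideanSpace ℝ (Fin 6))))) Filter.atTop (𝓝 0) →
      ∀ A : ℝ≥0∞, A < ⊤ →
      Filter.Tendsto (fun k => μH[4] (Set.range (ι k))) Filter.atTop (𝓝 A) →
      A ≤ μH[4] (Metric.sphere (0 : EuclideanSpace ℝ (Fin 5)) 1) := by
  intro M _ _ _ _ _ _ _ _ _ ι ν hemb hN hsep himm hun hνN hνs B hB δ hδ hent hW A hA hAr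
  set V : ℝ≥0∞ := μH[4] (Metric.sphere (0 : EuclideanSpace ℝ (Fin 5)) 1) with hV
  have hV0 : V ≠ 0 := hausdorffMeasure_sphere_four_pos.ne'
  have hVtop : V ≠ ⊤ := hausdorffMeasure_sphere_four_lt_top.ne
  obtain ⟨m, hm⟩ := hquant M ι ν hemb hN hsep himm hun hνN hνs B hB hW A hA hAr
  -- every area is `≥ vol` and `≤ (2 - δ) vol`
  have hlo : ∀ k, V ≤ μH[4] (Set.range (ι k)) := fun k => floor_le_of_separatesEnds (hsep k)
  have hhi : ∀ k, μH[4] (Set.range (ι k)) ≤ ENNReal.ofReal (2 - δ) * V := by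
    intro k
    have hcpt : IsCompact (Set.range (ι k)) := isCompact_range (hemb k).contMDiff.continuous
    have hmeas : MeasurableSet (Set.range (ι k)) := hcpt.isClosed.measurableSet
    have hN' : ∀ z ∈ Set.range (ι k), ∑ i : Fin 5, z (Fin.castSucc i) ^ 2 = 1 := by
      rintro z ⟨x, rfl⟩; exact hN k x
    have hB' : ∀ z ∈ Set.range (ι k), |z 5| ≤ B := by
      rintro z ⟨x, rfl⟩; exact hB k x
    have key : V⁻¹ * μH[4] (Set.range (ι k)) ≤ ENNReal.ofReal (2 - δ) :=
      (measure_ratio_le_cylEntropy hmeas hN' hB').trans (hent k)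
    calc μH[4] (Set.range (ι k)) = V * (V⁻¹ * μH[4] (Set.range (ι k))) := by
          rw [← mul_assoc, ENNReal.mul_inv_cancel hV0 hVtop, one_mul]
      _ ≤ V * ENNReal.ofReal (2 - δ) := by gcongr
      _ = ENNReal.ofReal (2 - δ) * V := mul_comm _ _
  have hAlo : V ≤ A := ge_of_tendsto' hAr hlo
  have hAhi : A ≤ ENNReal.ofReal (2 - δ) * V := le_of_tendsto' hAr hhi
  -- `vol ≤ m vol ≤ (2 - δ) vol < 2 vol` forces `m = 1`
  have hm1 : m = 1 := by
    rcases Nat.lt_or_ge m 2 with hlt | hge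
    · interval_cases m
      · exfalso
        rw [hm, Nat.cast_zero, zero_mul] at hAlo
        exact hV0 (le_antisymm hAlo bot_le)
      · rfl
    · exfalso
      have h2 : (2 : ℝ≥0∞) * V ≤ A := by
        rw [hm]
        gcongr
        exact_mod_cast hge
      have h3 : (2 : ℝ≥0∞) * V ≤ ENNReal.ofReal (2 - δ) * V := h2.trans hAhi
      have h4 : (2 : ℝ≥0∞) ≤ ENNReal.ofReal (2 - δ) := (ENNReal.mul_le_mul_iff_left hV0 hVtop).1 h3
      have h5 : ENNReal.ofReal (2 - δ) < 2 := by
        rw [← ENNReal.ofReal_ofNat 2]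
        exact (ENNReal.ofReal_lt_ofReal_iff zero_lt_two).2 (by norm_num; exact hδ)
      exact absurd h4 (not_le.2 h5)
  rw [hm, hm1, Nat.cast_one, one_mul]

/-- **The `ε`-form implies the thin sequence form.**  If for all `δ, η > 0` and `B` there is `ε > 0` such that
every compact connected embedded separating cross-section in the slab `|z₅| ≤ B` with `λ_cyl ≤ 2 - δ` and Willmore
energy `∫ H² d(ι^*μH⁴) ≤ ε` has area `≤ (1 + η) vol` (for every `M`), then almost-stationary sequences of such
cross-sections on one `M` have area limit `A ≤ vol` (`A ≤ (1+η) vol` for every `η > 0` by the eventual smallness of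
`∫ H_k²`, and `η → 0`). [folklore] -/
theorem thinSeq_of_areaNearFloorOfSmallWillmore
    (hstatic : ∀ δ : ℝ, 0 < δ → ∀ B η : ℝ, 0 < η → ∃ ε : ℝ, 0 < ε ∧
      ∀ (M : Type) [TopologicalSpace M] [T2Space M] [SecondCountableTopology M]
        [ChartedSpace (EuclideanSpace ℝ (Fin 4)) M] [IsManifold (𝓡 4) ∞ M] [CompactSpace M]
        [ConnectedSpace M] [MeasurableSpace M] [BorelSpace M]
        (ι ν : M → EuclideanSpace ℝ (Fin 6)),
        Manifold.IsSmoothEmbedding (𝓡 4) (𝓡 6) ∞ ι →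
        (∀ x, ∑ i : Fin 5, ι x (Fin.castSucc i) ^ 2 = 1) →
        SeparatesEnds (Set.range ι) →
        ∀ himm : (euclideanMetric (EuclideanSpace ℝ (Fin 6))).IsSpacelikeImmersion (𝓡 4) ι,
        (euclideanMetric (EuclideanSpace ℝ (Fin 6))).IsUnitNormal (𝓡 4) ι ν 1 →
        (∀ x, ∑ i : Fin 5, ν x (Fin.castSucc i) * ι x (Fin.castSucc i) = 0) →
        ContMDiff (𝓡 4) (𝓡 6) ∞ ν →
        (∀ x, |ι x 5| ≤ B) →
        cylEntropy (Set.range ι) ≤ ENNReal.ofReal (2 - δ) →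
        ∫⁻ x, ENNReal.ofReal
            ((euclideanMetric (EuclideanSpace ℝ (Fin 6))).meanCurvature ι contMDiff_pullbackBilin_holds himm ν x ^ 2)
            ∂(Measure.comap ι (μH[4] : Measure (EuclideanSpace ℝ (Fin 6)))) ≤ ENNReal.ofReal ε →
        μH[4] (Set.range ι) ≤
          ENNReal.ofReal (1 + η) * μH[4] (Metric.sphere (0 : EuclideanSpace ℝ (Fin 5)) 1)) :
    ∀ (M : Type) [TopologicalSpace M] [T2Space M] [SecondCountableTopology M]
      [ChartedSpace (EuclideanSpace ℝ (Fin 4)) M] [IsManifold (𝓡 4) ∞ M] [CompactSpace M] [ConnectedSpace M]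
      [MeasurableSpace M] [BorelSpace M]
      (ι : ℕ → M → EuclideanSpace ℝ (Fin 6)) (ν : ℕ → M → EuclideanSpace ℝ (Fin 6)),
      (∀ k, Manifold.IsSmoothEmbedding (𝓡 4) (𝓡 6) ∞ (ι k)) →
      (∀ k x, ∑ i : Fin 5, ι k x (Fin.castSucc i) ^ 2 = 1) →
      (∀ k, SeparatesEnds (Set.range (ι k))) →
      ∀ himm : ∀ k, (euclideanMetric (EuclideanSpace ℝ (Fin 6))).IsSpacelikeImmersion (𝓡 4) (ι k),
      (∀ k, (euclideanMetric (EuclideanSpace ℝ (Fin 6))).IsUnitNormal (𝓡 4) (ι k) (ν k) 1) →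
      (∀ k x, ∑ i : Fin 5, ν k x (Fin.castSucc i) * ι k x (Fin.castSucc i) = 0) →
      (∀ k, ContMDiff (𝓡 4) (𝓡 6) ∞ (ν k)) →
      ∀ B : ℝ, (∀ k x, |ι k x 5| ≤ B) →
      ∀ δ : ℝ, 0 < δ → (∀ k, cylEntropy (Set.range (ι k)) ≤ ENNReal.ofReal (2 - δ)) →
      Filter.Tendsto (fun k => ∫⁻ x, ENNReal.ofReal
          ((euclideanMetric (EuclideanSpace ℝ (Fin 6))).meanCurvature (ι k) contMDiff_pullbackBilin_holds (himm k)
            (ν k) x ^ 2) ∂(Measure.comap (ι k) (μH[4] : Measure (EuclideanSpace ℝ (Fin 6))))) Filter.atTop (𝓝 0) →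
      ∀ A : ℝ≥0∞, A < ⊤ →
      Filter.Tendsto (fun k => μH[4] (Set.range (ι k))) Filter.atTop (𝓝 A) →
      A ≤ μH[4] (Metric.sphere (0 : EuclideanSpace ℝ (Fin 5)) 1) := by
  intro M _ _ _ _ _ _ _ _ _ ι ν hemb hN hsep himm hun hνN hνs B hB δ hδ hent hW A _hA hAr
  set V : ℝ≥0∞ := μH[4] (Metric.sphere (0 : EuclideanSpace ℝ (Fin 5)) 1) with hV
  have hV0 : V ≠ 0 := hausdorffMeasure_sphere_four_pos.ne'
  have hVtop : V ≠ ⊤ := hausdorffMeasure_sphere_four_lt_top.ne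
  -- `A ≤ (1 + η) vol` for every `η > 0`
  have hη : ∀ η : ℝ, 0 < η → A ≤ ENNReal.ofReal (1 + η) * V := by
    intro η hη
    obtain ⟨ε, hε, hstat⟩ := hstatic δ hδ B η hη
    have hev : ∀ᶠ k in Filter.atTop, ∫⁻ x, ENNReal.ofReal
        ((euclideanMetric (EuclideanSpace ℝ (Fin 6))).meanCurvature (ι k) contMDiff_pullbackBilin_holds (himm k)
          (ν k) x ^ 2) ∂(Measure.comap (ι k) (μH[4] : Measure (EuclideanSpace ℝ (Fin 6)))) < ENNReal.ofReal ε :=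
      (tendsto_order.1 hW).2 _ (ENNReal.ofReal_pos.2 hε)
    refine le_of_tendsto hAr (hev.mono fun k hk => ?_)
    exact hstat M (ι k) (ν k) (hemb k) (hN k) (hsep k) (himm k) (hun k) (hνN k) (hνs k) (hB k) (hent k) hk.le
  -- `η → 0`
  refine ENNReal.le_of_forall_pos_le_add fun γ hγ _ => ?_
  have hVr : 0 < V.toReal := ENNReal.toReal_pos hV0 hVtop
  calc A ≤ ENNReal.ofReal (1 + (γ : ℝ) / V.toReal) * V := hη _ (div_pos (by exact_mod_cast hγ) hVr)
    _ = V + (γ : ℝ≥0∞) := by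
        rw [ENNReal.ofReal_add zero_le_one (div_pos (by exact_mod_cast hγ) hVr).le, ENNReal.ofReal_one,
          add_mul, one_mul, ENNReal.ofReal_div_of_pos hVr, ENNReal.ofReal_toReal hVtop,
          ENNReal.ofReal_coe_nnreal, ENNReal.div_mul_cancel hV0 hVtop]

/-- **Area to the floor from the thin sequence form** (item `ImmortalAreaToFloor`, stmt-SmoothPoincare4-17197, in the
folded vocabulary): along an immortal cylinder flow of a compact connected cross-section with separating slices of
entropy `< 2`, some slice has area `≤ (1 + ε) vol`, GIVEN that almost-stationary slab-confined separating sequences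
with `λ_cyl ≤ 2 - δ` have area limits `≤ vol` (hypothesis `hthin`).  Proof as for the landed
`helper_areaToFloorOfQuantization`: `areaToFloor_iff_iInf_le`, antitone finite areas (`stub_areaDissipation`,
`measure_range_lt_two_mul`), good times of the dissipation budget (`stub_dissipationBudget`,
`exists_lt_of_setLIntegral_le`, `norm_deriv_sq`), the uniform height bound (`exists_height_bound`) and the uniform
entropy gap (inlined; cf. the landed `IsCylinderMCF.exists_cylEntropy_le_ofReal_two_sub`); `hthin` at the
good-time sequence gives `A_∞ ≤ vol`.
[cite: Hamilton1993, Thm. 4.1] [cite: Brakke1978, §3] -/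
theorem areaToFloor_of_thinSeq
    (hthin : ∀ (M : Type) [TopologicalSpace M] [T2Space M] [SecondCountableTopology M]
      [ChartedSpace (EuclideanSpace ℝ (Fin 4)) M] [IsManifold (𝓡 4) ∞ M] [CompactSpace M] [ConnectedSpace M]
      [MeasurableSpace M] [BorelSpace M]
      (ι : ℕ → M → EuclideanSpace ℝ (Fin 6)) (ν : ℕ → M → EuclideanSpace ℝ (Fin 6)),
      (∀ k, Manifold.IsSmoothEmbedding (𝓡 4) (𝓡 6) ∞ (ι k)) →
      (∀ k x, ∑ i : Fin 5, ι k x (Fin.castSucc i) ^ 2 = 1) →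
      (∀ k, SeparatesEnds (Set.range (ι k))) →
      ∀ himm : ∀ k, (euclideanMetric (EuclideanSpace ℝ (Fin 6))).IsSpacelikeImmersion (𝓡 4) (ι k),
      (∀ k, (euclideanMetric (EuclideanSpace ℝ (Fin 6))).IsUnitNormal (𝓡 4) (ι k) (ν k) 1) →
      (∀ k x, ∑ i : Fin 5, ν k x (Fin.castSucc i) * ι k x (Fin.castSucc i) = 0) →
      (∀ k, ContMDiff (𝓡 4) (𝓡 6) ∞ (ν k)) →
      ∀ B : ℝ, (∀ k x, |ι k x 5| ≤ B) →
      ∀ δ : ℝ, 0 < δ → (∀ k, cylEntropy (Set.range (ι k)) ≤ ENNReal.ofReal (2 - δ)) →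
      Filter.Tendsto (fun k => ∫⁻ x, ENNReal.ofReal
          ((euclideanMetric (EuclideanSpace ℝ (Fin 6))).meanCurvature (ι k) contMDiff_pullbackBilin_holds (himm k)
            (ν k) x ^ 2) ∂(Measure.comap (ι k) (μH[4] : Measure (EuclideanSpace ℝ (Fin 6))))) Filter.atTop (𝓝 0) →
      ∀ A : ℝ≥0∞, A < ⊤ →
      Filter.Tendsto (fun k => μH[4] (Set.range (ι k))) Filter.atTop (𝓝 A) →
      A ≤ μH[4] (Metric.sphere (0 : EuclideanSpace ℝ (Fin 5)) 1)) :
    ∀ (M : Type) [TopologicalSpace M] [T2Space M] [SecondCountableTopology M]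
      [ChartedSpace (EuclideanSpace ℝ (Fin 4)) M] [IsManifold (𝓡 4) ∞ M] [CompactSpace M]
      [ConnectedSpace M]
      (F : ℝ → M → EuclideanSpace ℝ (Fin 6)) (ν : ℝ → M → EuclideanSpace ℝ (Fin 6)) (T : ℝ),
      IsCylinderMCF M F ν T →
      (∀ t, T ≤ t → SeparatesEnds (Set.range (F t))) →
      (∀ t, T ≤ t → cylEntropy (Set.range (F t)) < 2) →
      ∀ ε : ℝ, 0 < ε → ∃ t : ℝ, T ≤ t ∧
        μH[4] (Set.range (F t)) ≤
          ENNReal.ofReal (1 + ε) * μH[4] (Metric.sphere (0 : EuclideanSpace ℝ (Fin 5)) 1) := by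
  intro M _ _ _ _ _ _ _ F ν T hflow hsep hent
  -- Borel structure on `M`
  letI : MeasurableSpace M := borel M
  haveI : BorelSpace M := ⟨rfl⟩
  -- uniform entropy gap (as in the landed `IsCylinderMCF.exists_cylEntropy_le_ofReal_two_sub`: the initial entropy
  -- is finite and the entropy is non-increasing, `cylEntropy_range_le_of_le`) and the uniform height bound
  obtain ⟨δ, hδ, hgap⟩ : ∃ δ : ℝ, 0 < δ ∧ ∀ t, T ≤ t → cylEntropy (Set.range (F t)) ≤ ENNReal.ofReal (2 - δ) := by
    have hT := hent T le_rfl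
    have htop : cylEntropy (Set.range (F T)) ≠ ⊤ := ne_top_of_lt hT
    have hl2 : (cylEntropy (Set.range (F T))).toReal < 2 := by
      have h := (ENNReal.toReal_lt_toReal htop ENNReal.ofNat_ne_top).2 hT
      rwa [ENNReal.toReal_ofNat] at h
    refine ⟨2 - (cylEntropy (Set.range (F T))).toReal, by linarith, fun t ht => ?_⟩
    rw [sub_sub_cancel, ENNReal.ofReal_toReal htop]
    exact hflow.cylEntropy_range_le_of_le le_rfl ht
  obtain ⟨B, hB⟩ := hflow.exists_height_bound
  set V : ℝ≥0∞ := μH[4] (Metric.sphere (0 : EuclideanSpace ℝ (Fin 5)) 1) with hV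
  -- the areas
  set a : ℝ → ℝ≥0∞ := fun t => μH[4] (Set.range (F t)) with ha
  rw [areaToFloor_iff_iInf_le a T]
  set Ainf : ℝ≥0∞ := ⨅ t ∈ Set.Ici T, a t with hAinf
  have haT : a T < 2 * V := hflow.measure_range_lt_two_mul le_rfl (hent T le_rfl)
  have haTtop : a T ≠ ⊤ := ne_top_of_lt haT
  have hanti : AntitoneOn a (Set.Ici T) := stub_areaDissipation M F ν T hflow
  have hAinf_le : ∀ t, T ≤ t → Ainf ≤ a t := fun t ht => iInf₂_le t (Set.mem_Ici.2 ht)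
  have hAinf_top : Ainf < ⊤ := lt_of_le_of_lt (hAinf_le T le_rfl) (lt_top_iff_ne_top.2 haTtop)
  -- the speed integral and its budget
  set f : ℝ → ℝ≥0∞ := fun r => ∫⁻ x, ENNReal.ofReal (‖deriv (fun s => F s x) r‖ ^ 2)
      ∂(Measure.comap (F r) (μH[4] : Measure (EuclideanSpace ℝ (Fin 6)))) with hf
  have hbudget : ∀ t, T ≤ t → ∫⁻ r in Set.Icc T t, f r ≤ a T := fun t ht =>
    le_trans le_self_add (stub_dissipationBudget M F ν T hflow t ht)
  have hsmall : ∀ n : ℕ, ∃ r : ℝ, T + n ≤ r ∧ f r < ENNReal.ofReal (1 / ((n : ℝ) + 1)) := by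
    intro n
    refine exists_lt_of_setLIntegral_le (t₀ := T + n) haTtop (fun L hL => ?_) (by positivity)
    have hn : (0 : ℝ) ≤ n := Nat.cast_nonneg n
    calc ∫⁻ r in Set.Icc (T + n) (T + n + L), f r ≤ ∫⁻ r in Set.Icc T (T + n + L), f r :=
          lintegral_mono_set (Set.Icc_subset_Icc_left (by linarith))
      _ ≤ a T := hbudget _ (by linarith)
  choose r hrT hrf using hsmall
  have hr : ∀ n, T ≤ r n := fun n =>
    le_trans (le_add_of_nonneg_right (Nat.cast_nonneg n)) (hrT n)
  have hf0 : Tendsto (fun n => f (r n)) atTop (𝓝 0) := by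
    have h1 : Tendsto (fun n : ℕ => ENNReal.ofReal (1 / ((n : ℝ) + 1))) atTop (𝓝 0) := by
      rw [← ENNReal.ofReal_zero]
      exact ENNReal.tendsto_ofReal tendsto_one_div_add_atTop_nhds_zero_nat
    exact tendsto_of_tendsto_of_tendsto_of_le_of_le tendsto_const_nhds h1 (fun _ => bot_le)
      fun n => (hrf n).le
  have hrtop : Tendsto r atTop atTop := by
    refine tendsto_atTop_mono hrT ?_
    exact tendsto_atTop_add_const_left _ _ tendsto_natCast_atTop_atTop
  have haA : Tendsto (fun n => a (r n)) atTop (𝓝 Ainf) := by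
    refine tendsto_order.2 ⟨fun b hb => Eventually.of_forall fun n => lt_of_lt_of_le hb (hAinf_le _ (hr n)),
      fun b hb => ?_⟩
    obtain ⟨t₁, ht₁⟩ := iInf_lt_iff.1 hb
    obtain ⟨hT₁, hlt₁⟩ := iInf_lt_iff.1 ht₁
    filter_upwards [hrtop.eventually_ge_atTop t₁] with n hn
    exact lt_of_le_of_lt (hanti hT₁ (Set.mem_Ici.2 (hr n)) hn) hlt₁
  have hH0 : Tendsto (fun n => ∫⁻ x, ENNReal.ofReal
      ((euclideanMetric (EuclideanSpace ℝ (Fin 6))).meanCurvature (F (r n)) contMDiff_pullbackBilin_holds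
        (hflow.isSpacelikeImmersion (r n) (hr n)) (ν (r n)) x ^ 2)
      ∂(Measure.comap (F (r n)) (μH[4] : Measure (EuclideanSpace ℝ (Fin 6))))) atTop (𝓝 0) := by
    refine hf0.congr fun n => ?_
    simp only [hf]
    refine lintegral_congr fun x => ?_
    rw [hflow.norm_deriv_sq (hr n) x]
  -- the thin sequence form at the good times
  exact hthin M (fun n => F (r n)) (fun n => ν (r n))
    (fun n => hflow.isSmoothEmbedding (r n) (hr n)) (fun n x => hflow.mem_cyl (r n) (hr n) x)
    (fun n => hsep (r n) (hr n)) (fun n => hflow.isSpacelikeImmersion (r n) (hr n))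
    (fun n => hflow.isUnitNormal (r n) (hr n)) (fun n x => hflow.normal_tangent (r n) (hr n) x)
    (fun n => hflow.contMDiff_normal (r n) (hr n)) B (fun n x => hB (r n) (hr n) x) δ hδ
    (fun n => hgap (r n) (hr n)) hH0 Ainf hAinf_top haA

end Summit.SmoothPoincare4.SmoothPoincare4.Cruxes.CylinderRungTwo.KillingFlux

namespace Summit.SmoothPoincare4.SmoothPoincare4.Theorems

open Literature.Geometry.Riemannian
open Literature.Geometry.Lorentzian Literature.Geometry.Lorentzian.PseudoRiemannianMetric
open Literature.Geometry.Riemannian.SphericalCylinderEntropy (cylEntropy)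
open Summit.SmoothPoincare4.SmoothPoincare4.Cruxes.CylinderRungTwo.KillingFlux

/-- **The item `ImmortalAreaToFloor` (stmt-SmoothPoincare4-17197) AS TYPED, from the thin sequence form**
(`areaToFloor_of_thinSeq` with the item's statement unfolded, as in
`immortalAreaToFloor_of_areaNearFloorOfSmallTilt`).  The hypothesis is implied by the route's crux
`AreaQuantization` (`thinSeq_of_areaQuantization`) and by the `ε`-form (`thinSeq_of_areaNearFloorOfSmallWillmore`).
[cite: Hamilton1993, Thm. 4.1] [cite: Brakke1978, §3] -/
theorem immortalAreaToFloor_of_thinSeq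
    (hthin : ∀ (M : Type) [TopologicalSpace M] [T2Space M] [SecondCountableTopology M]
      [ChartedSpace (EuclideanSpace ℝ (Fin 4)) M] [IsManifold (𝓡 4) ∞ M] [CompactSpace M] [ConnectedSpace M]
      [MeasurableSpace M] [BorelSpace M]
      (ι : ℕ → M → EuclideanSpace ℝ (Fin 6)) (ν : ℕ → M → EuclideanSpace ℝ (Fin 6)),
      (∀ k, Manifold.IsSmoothEmbedding (𝓡 4) (𝓡 6) ∞ (ι k)) →
      (∀ k x, ∑ i : Fin 5, ι k x (Fin.castSucc i) ^ 2 = 1) →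
      (∀ k, SeparatesEnds (Set.range (ι k))) →
      ∀ himm : ∀ k, (euclideanMetric (EuclideanSpace ℝ (Fin 6))).IsSpacelikeImmersion (𝓡 4) (ι k),
      (∀ k, (euclideanMetric (EuclideanSpace ℝ (Fin 6))).IsUnitNormal (𝓡 4) (ι k) (ν k) 1) →
      (∀ k x, ∑ i : Fin 5, ν k x (Fin.castSucc i) * ι k x (Fin.castSucc i) = 0) →
      (∀ k, ContMDiff (𝓡 4) (𝓡 6) ∞ (ν k)) →
      ∀ B : ℝ, (∀ k x, |ι k x 5| ≤ B) →
      ∀ δ : ℝ, 0 < δ → (∀ k, cylEntropy (Set.range (ι k)) ≤ ENNReal.ofReal (2 - δ)) →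
      Filter.Tendsto (fun k => ∫⁻ x, ENNReal.ofReal
          ((euclideanMetric (EuclideanSpace ℝ (Fin 6))).meanCurvature (ι k) contMDiff_pullbackBilin_holds (himm k)
            (ν k) x ^ 2) ∂(Measure.comap (ι k) (μH[4] : Measure (EuclideanSpace ℝ (Fin 6))))) Filter.atTop (𝓝 0) →
      ∀ A : ℝ≥0∞, A < ⊤ →
      Filter.Tendsto (fun k => μH[4] (Set.range (ι k))) Filter.atTop (𝓝 A) →
      A ≤ μH[4] (Metric.sphere (0 : EuclideanSpace ℝ (Fin 5)) 1)) :
    (haveI : (Literature.Geometry.Riemannian.euclideanMetric (EuclideanSpace ℝ (Fin 6))).HasLeviCivita := Literature.Geometry.Riemannian.instHasLeviCivitaEuclideanMetric; ∀ (M : Type) [TopologicalSpace M] [T2Space M] [SecondCountableTopology M] [ChartedSpace (EuclideanSpace ℝ (Fin 4)) M] [IsManifold (𝓡 4) ∞ M] [CompactSpace M] [ConnectedSpace M] (F : ℝ → M → EuclideanSpace ℝ (Fin 6)) (ν : ℝ → M → EuclideanSpace ℝ (Fin 6)) (T : ℝ), (∃ U : Set ℝ, IsOpen U ∧ Set.Ici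 T ⊆ U ∧ ContMDiffOn (𝓘(ℝ, ℝ).prod (𝓡 4)) (𝓡 6) ∞ (fun q : ℝ × M => F q.1 q.2) (U ×ˢ Set.univ)) → (∀ t, T ≤ t → Manifold.IsSmoothEmbedding (𝓡 4) (𝓡 6) ∞ (F t)) → (∀ t, T ≤ t → ∀ x, ∑ i : Fin 5, F t x (Fin.castSucc i) ^ 2 = 1) → ∀ himm : (∀ t, T ≤ t → (Literature.Geometry.Riemannian.euclideanMetric (EuclideanSpace ℝ (Fin 6))).IsSpacelikeImmersion (𝓡 4) (F t)), (∀ t, T ≤ t → (Literature.Geometry.Riemannian.euclideanMetric (EuclideanSpace ℝ (Fin 6))).IsUnitNormal (𝓡 4) (F t) (ν t) 1) → (∀ t, T ≤ t → ∀ x, ∑ i : Fin 5, ν t x (Fin.castSucc i) * F t x (Fin.castSucc i) = 0) → (∀ t, T ≤ t → ContMDiff (𝓡 4) (𝓡 6) ∞ (ν t)) → (∀ t (ht : T ≤ t) (x : M), mfderiv 𝓘(ℝ, ℝ) (𝓡 6) (fun s => F s x) t (1 : ℝ) = -((Literature.Geometry.Riemannian.euclideanMetric (EuclideanSpace ℝ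 (Fin 6))).meanCurvature (F t) Literature.Geometry.Lorentzian.PseudoRiemannianMetric.contMDiff_pullbackBilin_holds (himm t ht) (ν t) x) • ν t x) → (∀ t, T ≤ t → (∃ R : ℝ, ∀ a b : EuclideanSpace ℝ (Fin 6), ∑ i : Fin 5, a (Fin.castSucc i) ^ 2 = 1 → ∑ i : Fin 5, b (Fin.castSucc i) ^ 2 = 1 → a 5 ≤ -R → R ≤ b 5 → ¬ JoinedIn ({z : EuclideanSpace ℝ (Fin 6) | ∑ i : Fin 5, z (Fin.castSucc i) ^ 2 = 1} \ Set.range (F t)) a b)) → (∀ t, T ≤ t → (⨆ (p : EuclideanSpace ℝ (Fin 6)) (_ : ∑ i : Fin 5, p (Fin.castSucc i) ^ 2 = 1) (τ : ℝ) (_ : 0 < τ), (μH[4] (Metric.sphere (0 : EuclideanSpace ℝ (Fin 5)) 1))⁻¹ * ∫⁻ z in Set.range (F t), ENNReal.ofReal ((∑' k : ℕ, Real.exp (-((k : ℝ) * ((k : ℝ) + 3)) * τ) * ((2 * (k : ℝ) + 3) / 3) * ∑ l ∈ Finset.range (k / 2 + 1), (-1 : ℝ) ^ l * (∏ j ∈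 Finset.range (k - l), ((3 : ℝ) / 2 + (j : ℝ))) / (((l.factorial : ℕ) : ℝ) * (((k - 2 * l).factorial : ℕ) : ℝ)) * (2 * ∑ i : Fin 5, z (Fin.castSucc i) * p (Fin.castSucc i)) ^ (k - 2 * l)) * Real.exp (-((z 5 - p 5) ^ 2) / (4 * τ))) ∂μH[4]) < 2) → ∀ ε : ℝ, 0 < ε → ∃ t : ℝ, T ≤ t ∧ μH[4] (Set.range (F t)) ≤ ENNReal.ofReal (1 + ε) * μH[4] (Metric.sphere (0 : EuclideanSpace ℝ (Fin 5)) 1)) := by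
  intro M _ _ _ _ _ _ _ F ν T hU hemb hN himm hun hνN hνs hvel hsep hent
  exact areaToFloor_of_thinSeq hthin M F ν T ⟨hU, hemb, hN, himm, hun, hνN, hνs, hvel⟩ hsep hent

end Summit.SmoothPoincare4.SmoothPoincare4.Theorems

end
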